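import Summits.QuantumAdvantage.AdviceFreeQNC0.AffBells37Expansion
import Summits.QuantumAdvantage.AdviceFreeQNC0.Resonance37G
import Summits.QuantumAdvantage.AdviceFreeQNC0.AffBells26MoveSystems
import Summits.QuantumAdvantage.AdviceFreeQNC0.RingHardOdd
import HarnessLib

/-!
# Cell qa-qnc0 — rung (NP-Γ) `RingHardSparse3` (sparse-coupling hardness at `p = 3`, any degree): Part III-a — generic pair slicing along a separated window system.

Planner qa-qnc0-p2 gen 34 (INBOX P2-34c/P2-34d, memo HOME/qa-qnc0-p2/ROUND-34P2.md §4.4); split of the kernel-checked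
monolith `HOME/qa-qnc0-p2/line34/NPGammaProof37.lean` (rc 0, 0 sorries, axioms propext/Classical.choice/Quot.sound) into
≤ 400-line parts `NPGamma37{Slicing,Span,Family,Assembly,Sparse}.lean`.  Part I (𝔽₄ Kraft + sparsity) and the 𝔽₄/ℤ₃ algebra
are IMPORTED from the landed (NP₁) files `AffBells37{Kraft,Sparse,Resonance}`, Part II (the insulator-involution resonance
MGF (R′)) from the landed `Resonance37G` — identical declarations, opened by name below.

THIS FILE: `Sep`, the slice `U p a v`, `xOfU_U_eq` (flipping `u_{p j}` flips exactly `x_{p j}, x_{p j+1}`), the walk exponent on a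
slice (`walkExp_U`), the transported strategy and (S1).

THEOREM (NP-Γ, file `NPGamma37Sparse`): for `n ≥ 200`, every strategy `P : Fin n → CubeFn (ZMod 3) n` with all outputs in
`span {mono S : S ∈ 𝓢}`, `𝓢` admitting `8·log₂ n` insulated windows (`NPGamma37.InsulatedWindows`), satisfies
`#{x odd : Rel x (P · x = 1)} ≤ (1 − n^{−6})·2^{n−1}` — no degree hypothesis.  Supports crux stmt-QuantumAdvantage-22907
(dense coupling — the residual core of `RingHardOdd 3` — is NOT touched).
-/

noncomputable section

namespace Summit.QuantumAdvantage.AdviceFreeQNC0.NPGamma37Proof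

open Finset F4
open Classical
open Summit.QuantumAdvantage.AdviceFreeQNC0.AffBells37 (expo chiZ exists_ne_one_of_mass_lt ev L sparse sparse_ne_one
  two_pow_L_le ωz ωz_zero ωz_add ωz_natCast ωz_sq lin chiZ_eq_ωz lin_add lin_mul lin_single ιF_xor ιF_decide_eq_zero
  ιF_eq_omega ιF_ringWinU)
open Summit.QuantumAdvantage.AdviceFreeQNC0.Resonance37G (four_orbit_le orbit_mgf sg bt sg_not slope_eq no_three
  blockCpl blockCpl_blockCpl blockCpl_involutive blockCpl_apply_of_not_mem uExt_blockCpl xN xN_eq_xOfU xN_blockCpl_of_ne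
  xN_blockCpl_left xN_blockCpl_right Inv letter resonance_windows)
-- `wt` (weight of a cube-restricted character) is written `AffBells37.wt` throughout: the bare name would resolve to the
-- walk-word weight `Summit.QuantumAdvantage.AdviceFreeQNC0.wt` of `Elimination.lean`.

variable {F : ℕ}

/-! ## Part III — slicing along a separated window system (arbitrary positions)

Free walk positions `p j` (`j < F`), pairwise `≥ 3` apart, `1 ≤ p j`, `p j + 1 < n`; the slice through `a` is
`{U a v = a ⊕ w(v)}`; flipping `u_{p j}` flips exactly `x_{p j}` and `x_{p j + 1}`. -/

section Slicing

open Literature.Computability.QuantumComplexity Literature.Computability.QuantumComplexity.RingHLF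
open Literature.Computability.MetaComplexity
open AffBells23 AffBells26

variable {n : ℕ}

/-- separation of a window system: `1 ≤ p j`, `p j + 1 < n`, consecutive free positions `≥ 3` apart. -/
def Sep (n F : ℕ) (p : ℕ → ℕ) : Prop :=
  (∀ j : Fin F, 1 ≤ p j ∧ p j + 1 < n) ∧ (∀ j j' : Fin F, j.val < j'.val → p j + 3 ≤ p j')

/-- Distinct free positions of a separated system are at distance `≥ 3`. -/
theorem Sep.ne {p : ℕ → ℕ} (hS : Sep n F p) {j j' : Fin F} (h : j ≠ j') : p j + 3 ≤ p j' ∨ p j' + 3 ≤ p j := by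
  rcases lt_or_gt_of_ne (fun hh : j.val = j'.val => h (Fin.ext hh)) with hlt | hgt
  · exact Or.inl (hS.2 j j' hlt)
  · exact Or.inr (hS.2 j' j hgt)

/-- The free-position map of a separated system is injective. -/
theorem Sep.inj {p : ℕ → ℕ} (hS : Sep n F p) {j j' : Fin F} (h : p j = p j') : j = j' := by
  by_contra hne
  rcases hS.ne hne with h1 | h1 <;> omega

/-- the free-bit translate, `ℕ`-indexed: `w(v)_m = v_j` if `m = p j`, else `false`. -/
def wE (p : ℕ → ℕ) (v : Fin F → Bool) (m : ℕ) : Bool := decide (∃ j : Fin F, p j = m ∧ v j = true)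

/-- the slice point `U a v = a ⊕ w(v)`. -/
def U (p : ℕ → ℕ) (a : Fin n → Bool) (v : Fin F → Bool) : Fin n → Bool := fun i => xor (a i) (wE p v i.val)

/-- `wE p v` at the free position `p j` reads `v_j`. -/
theorem wE_self {p : ℕ → ℕ} (hS : Sep n F p) (v : Fin F → Bool) (j : Fin F) : wE p v (p j) = v j := by
  unfold wE
  cases hv : v j
  · rw [decide_eq_false_iff_not]
    rintro ⟨j', hj', hv'⟩
    rw [hS.inj hj'] at hv'
    rw [hv] at hv'; exact Bool.false_ne_true hv'
  · rw [decide_eq_true_iff]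
    exact ⟨j, rfl, hv⟩

/-- `wE p v` vanishes away from the free positions. -/
theorem wE_false_of_ne {p : ℕ → ℕ} (v : Fin F → Bool) {m : ℕ} (h : ∀ j : Fin F, p j ≠ m) : wE p v m = false := by
  unfold wE
  rw [decide_eq_false_iff_not]
  rintro ⟨j, hj, _⟩
  exact h j hj

/-- `wE p v m` holds iff `m` is a free position `p j` with `v_j = true`. -/
theorem wE_true_iff {p : ℕ → ℕ} (v : Fin F → Bool) (m : ℕ) : wE p v m = true ↔ ∃ j : Fin F, p j = m ∧ v j = true := by
  unfold wE; rw [decide_eq_true_iff]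

/-- `U` is an involution in `a` for fixed `v`. -/
theorem U_U (p : ℕ → ℕ) (a : Fin n → Bool) (v : Fin F → Bool) : U p (U p a v) v = a := by
  funext i; unfold U; cases a i <;> cases wE p v i.val <;> rfl

/-- Summing over the slice map `a ↦ U p a v` (an involution) is summing over all `a`. -/
theorem sum_U {M : Type*} [AddCommMonoid M] (p : ℕ → ℕ) (f : (Fin n → Bool) → M) (v : Fin F → Bool) :
    ∑ a : Fin n → Bool, f (U p a v) = ∑ a : Fin n → Bool, f a := by
  have hinv : Function.Involutive (fun a : Fin n → Bool => U p a v) := fun a => U_U p a v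
  exact Equiv.sum_comp hinv.toPerm f

/-- Double counting: `Σ_v Σ_a f(U p a v) = 2^F · Σ_u f u`. -/
theorem sum_sum_U (p : ℕ → ℕ) (f : (Fin n → Bool) → ℕ) :
    ∑ v : Fin F → Bool, ∑ a : Fin n → Bool, f (U p a v) = 2 ^ F * ∑ u : Fin n → Bool, f u := by
  simp_rw [sum_U p f]
  rw [sum_const, card_univ, Fintype.card_fun, Fintype.card_bool, Fintype.card_fin, smul_eq_mul]

/-- The extended input of `U p a v` is that of `a` xor-ed with `wE p v`. -/
theorem uExt_U {p : ℕ → ℕ} (hS : Sep n F p) (a : Fin n → Bool) (v : Fin F → Bool) (m : ℕ) :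
    uExt (U p a v) m = xor (uExt a m) (wE p v m) := by
  unfold uExt U
  by_cases h : m < n
  · rw [dif_pos h, dif_pos h]
  · rw [dif_neg h, dif_neg h, wE_false_of_ne v (fun j hj => by have := (hS.1 j).2; omega)]; rfl

/-- the second reading position: `x_i` also reads `u_{i-1}`. -/
def wB (p : ℕ → ℕ) (v : Fin F → Bool) (i : ℕ) : Bool := if i = 0 then false else wE p v (i - 1)

/-- Walk bits of the slice point: `x_i(U p a v) = x_i(a) ⊕ wE(i) ⊕ wB(i)` (flipping `u_{p_j}` flips exactly `x_{p_j}, x_{p_j+1}`). -/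
theorem xOfU_U {p : ℕ → ℕ} (hS : Sep n F p) (a : Fin n → Bool) (v : Fin F → Bool) (i : Fin (n + 1)) :
    xOfU (U p a v) i = xor (xOfU a i) (xor (wE p v i.val) (wB p v i.val)) := by
  unfold xOfU wB
  simp only [uExt_U hS]
  by_cases h0 : i.val = 0
  · rw [if_pos h0, if_pos h0, if_pos h0]
    cases uExt a i.val <;> cases wE p v i.val <;> rfl
  · rw [if_neg h0, if_neg h0, if_neg h0]
    cases uExt a i.val <;> cases wE p v i.val <;> cases uExt a (i.val - 1) <;> cases wE p v (i.val - 1) <;> rfl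

/-- the flip predicate of `x_i` on the slice: `x_i` moves with `v_j` iff `i ∈ {p j, p j + 1}`. -/
theorem xOfU_U_eq {p : ℕ → ℕ} (hS : Sep n F p) (a : Fin n → Bool) (v : Fin F → Bool) (i : Fin (n + 1)) :
    xOfU (U p a v) i =
      if (∃ j : Fin F, (i.val = p j ∨ i.val = p j + 1) ∧ v j = true) then !xOfU a i else xOfU a i := by
  rw [xOfU_U hS]
  have hE : wE p v i.val = true ↔ ∃ j : Fin F, i.val = p j ∧ v j = true := by
    rw [wE_true_iff]
    exact ⟨fun ⟨j, h1, h2⟩ => ⟨j, h1.symm, h2⟩, fun ⟨j, h1, h2⟩ => ⟨j, h1.symm, h2⟩⟩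
  have hB : wB p v i.val = true ↔ ∃ j : Fin F, i.val = p j + 1 ∧ v j = true := by
    unfold wB
    by_cases h0 : i.val = 0
    · rw [if_pos h0]
      constructor
      · intro h; exact absurd h (by simp)
      · rintro ⟨j, hj, _⟩; omega
    · rw [if_neg h0, wE_true_iff]
      constructor
      · rintro ⟨j, h1, h2⟩; exact ⟨j, by omega, h2⟩
      · rintro ⟨j, h1, h2⟩; exact ⟨j, by omega, h2⟩
  have hexcl : ¬ (wE p v i.val = true ∧ wB p v i.val = true) := by
    rintro ⟨h1, h2⟩
    obtain ⟨j, hj, _⟩ := hE.1 h1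
    obtain ⟨j', hj', _⟩ := hB.1 h2
    by_cases hjj : j = j'
    · subst hjj; omega
    · rcases hS.ne hjj with h | h <;> omega
  by_cases hex : ∃ j : Fin F, (i.val = p j ∨ i.val = p j + 1) ∧ v j = true
  · rw [if_pos hex]
    obtain ⟨j, hj, hvj⟩ := hex
    rcases hj with hj | hj
    · have h1 : wE p v i.val = true := hE.2 ⟨j, hj, hvj⟩
      have h2 : wB p v i.val = false := by
        cases h : wB p v i.val
        · rfl
        · exact absurd ⟨h1, h⟩ hexcl
      rw [h1, h2]; cases xOfU a i <;> rfl
    · have h2 : wB p v i.val = true := hB.2 ⟨j, hj, hvj⟩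
      have h1 : wE p v i.val = false := by
        cases h : wE p v i.val
        · rfl
        · exact absurd ⟨h, h2⟩ hexcl
      rw [h1, h2]; cases xOfU a i <;> rfl
  · rw [if_neg hex]
    have h1 : wE p v i.val = false := by
      cases h : wE p v i.val
      · rfl
      · obtain ⟨j, hj, hvj⟩ := hE.1 h; exact absurd ⟨j, Or.inl hj, hvj⟩ hex
    have h2 : wB p v i.val = false := by
      cases h : wB p v i.val
      · rfl
      · obtain ⟨j, hj, hvj⟩ := hB.1 h; exact absurd ⟨j, Or.inr hj, hvj⟩ hex
    rw [h1, h2]; cases xOfU a i <;> rfl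

/-- re-indexing of an indicator sum along the free positions. -/
theorem sum_wE_reindex {M : Type*} [AddCommMonoid M] {p : ℕ → ℕ} (hS : Sep n F p) (v : Fin F → Bool)
    (G : Fin n → M) :
    ∑ i : Fin n, (if wE p v i.val = true then G i else 0)
      = ∑ j : Fin F, (if v j = true then G ⟨p j, by have := (hS.1 j).2; omega⟩ else 0) := by
  set e : Fin F → Fin n := fun j => ⟨p j, by have := (hS.1 j).2; omega⟩ with he
  have heinj : Function.Injective e := by
    intro j j' h
    have := congrArg Fin.val h
    exact hS.inj this
  have h1 : ∑ j : Fin F, (if v j = true then G (e j) else 0)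
      = ∑ i ∈ univ.image e, (if wE p v i.val = true then G i else 0) := by
    rw [sum_image (fun j _ j' _ h => heinj h)]
    exact sum_congr rfl fun j _ => by rw [show (e j).val = p j from rfl, wE_self hS]
  rw [h1]
  symm
  apply sum_subset (subset_univ _)
  intro i _ hi
  by_cases hwi : wE p v i.val = true
  · obtain ⟨j, hj, _⟩ := (wE_true_iff v i.val).1 hwi
    have hej : e j = i := Fin.ext hj
    exact absurd (hej ▸ mem_image_of_mem e (mem_univ j)) hi
  · rw [if_neg hwi]

/-- single-position indicator along the free positions. -/
theorem sum_ite_p_eq {M : Type*} [AddCommMonoid M] {p : ℕ → ℕ} (hS : Sep n F p) (v : Fin F → Bool)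
    (f : Bool → M) (hf : f false = 0) (i : ℕ) :
    ∑ j : Fin F, (if i = p j then f (v j) else 0) = f (wE p v i) := by
  by_cases h : ∃ j : Fin F, i = p j
  · obtain ⟨j, rfl⟩ := h
    rw [Finset.sum_eq_single j, if_pos rfl, wE_self hS]
    · intro j' _ hj'
      rw [if_neg]
      intro hh; exact hj' (hS.inj hh.symm)
    · intro hh; exact absurd (mem_univ j) hh
  · have hw : wE p v i = false := wE_false_of_ne v fun j hj => h ⟨j, hj.symm⟩
    rw [hw, hf]
    exact sum_eq_zero fun j _ => if_neg fun hh => h ⟨j, hh⟩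

/-- **LEMMA X**: `ι(x_i(U a v)) = ι(x_i(a)) + Σ_j [i ∈ {p j, p j + 1}] ι(v_j)`. -/
theorem ιF_xOfU_U {p : ℕ → ℕ} (hS : Sep n F p) (a : Fin n → Bool) (v : Fin F → Bool) (i : Fin (n + 1)) :
    ιF (xOfU (U p a v) i)
      = ιF (xOfU a i) + ∑ j : Fin F, (if i.val = p j ∨ i.val = p j + 1 then ιF (v j) else 0) := by
  rw [xOfU_U hS, ιF_xor, ιF_xor]
  have hsplit : ∀ j : Fin F, (if i.val = p j ∨ i.val = p j + 1 then ιF (v j) else 0)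
      = (if i.val = p j then ιF (v j) else 0) + (if i.val - 1 = p j ∧ i.val ≠ 0 then ιF (v j) else 0) := by
    intro j
    by_cases hA : i.val = p j
    · have hB : ¬ (i.val - 1 = p j ∧ i.val ≠ 0) := by omega
      rw [if_pos (Or.inl hA), if_pos hA, if_neg hB, add_zero]
    · by_cases hB : i.val = p j + 1
      · rw [if_pos (Or.inr hB), if_neg hA, if_pos (by omega), zero_add]
      · rw [if_neg (by omega), if_neg hA, if_neg (by omega), add_zero]
  rw [Fintype.sum_congr _ _ hsplit, sum_add_distrib, sum_ite_p_eq hS v ιF rfl i.val]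
  congr 1
  unfold wB
  by_cases h0 : i.val = 0
  · rw [if_pos h0]
    simp only [h0, ne_eq, not_true_eq_false, and_false, if_false, sum_const_zero]
    rfl
  · rw [if_neg h0]
    have : ∀ j : Fin F, (if i.val - 1 = p j ∧ i.val ≠ 0 then ιF (v j) else 0)
        = (if i.val - 1 = p j then ιF (v j) else 0) := by
      intro j; simp only [ne_eq, h0, not_false_eq_true, and_true]
    rw [Fintype.sum_congr _ _ this, sum_ite_p_eq hS v ιF rfl (i.val - 1)]

/-! #### the walk exponent on a slice -/

/-- `σ`-multiple of the PATH ROW: letter `σ · sg(u_{p j}) · λ_{jg}`, `λ = 2` if `p j < g` else `1`. -/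
def pathRow (p : ℕ → ℕ) (a : Fin n → Bool) (g : Fin (n + 1)) (σ : ZMod 3) : Fin F → ZMod 3 :=
  fun j => σ * (sg (uExt a (p j)) * (if p j < g.val then 2 else 1))

/-- `sg b ∈ {1, 2}` is nonzero. -/
theorem sg_ne_zero (b : Bool) : sg b ≠ 0 := by cases b <;> decide

/-- Every letter of a path row with `σ ≠ 0` is nonzero. -/
theorem pathRow_ne_zero (p : ℕ → ℕ) (a : Fin n → Bool) (g : Fin (n + 1)) {σ : ZMod 3} (hσ : σ ≠ 0) (j : Fin F) :
    pathRow p a g σ j ≠ 0 := by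
  unfold pathRow
  have h1 := sg_ne_zero (uExt a (p j))
  have h3 : ∀ x y z : ZMod 3, x ≠ 0 → y ≠ 0 → (z = 1 ∨ z = 2) → x * (y * z) ≠ 0 := by decide
  exact h3 σ _ _ hσ h1 (by split_ifs <;> simp)

/-- A path row with `σ ≠ 0` has full weight `F`. -/
theorem wt_pathRow (p : ℕ → ℕ) (a : Fin n → Bool) (g : Fin (n + 1)) {σ : ZMod 3} (hσ : σ ≠ 0) :
    AffBells37.wt (pathRow (F := F) p a g σ) = F := by
  unfold AffBells37.wt
  rw [Finset.filter_true_of_mem, card_univ, Fintype.card_fin]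
  intro j _
  exact pathRow_ne_zero p a g hσ j

/-- Indicator of a bit of `U p a v`: base bit plus a signed free-bit correction. -/
theorem ind_U (p : ℕ → ℕ) (a : Fin n → Bool) (v : Fin F → Bool) (i : Fin n) :
    (if U p a v i = true then (1 : ZMod 3) else 0)
      = (if a i = true then 1 else 0) + (if wE p v i.val = true then sg (a i) else 0) := by
  unfold U
  cases a i <;> cases wE p v i.val <;> simp [sg]
  all_goals decide

/-- Prefix-restricted indicator of a bit of `U p a v`: base bit plus a signed free-bit correction. -/
theorem ind_U_lt (p : ℕ → ℕ) (a : Fin n → Bool) (v : Fin F → Bool) (i : Fin n) (g : ℕ) :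
    (if (i.val < g ∧ U p a v i = true) then (1 : ZMod 3) else 0)
      = (if (i.val < g ∧ a i = true) then 1 else 0)
        + (if wE p v i.val = true then (if i.val < g then sg (a i) else 0) else 0) := by
  unfold U
  by_cases hg : i.val < g <;> cases a i <;> cases wE p v i.val <;> simp [hg, sg]
  all_goals decide

/-- `uExt a m = a m` for `m < n`. -/
theorem uExt_of_lt (a : Fin n → Bool) {m : ℕ} (h : m < n) : uExt a m = a ⟨m, h⟩ := by
  unfold uExt; rw [dif_pos h]

/-- **LEMMA W**: `e_g(U a v) ≡ e_g(a) + ⟨path_g, v⟩ (mod 3)`. -/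
theorem walkExp_U {p : ℕ → ℕ} (hS : Sep n F p) (a : Fin n → Bool) (v : Fin F → Bool) (g : Fin (n + 1)) :
    ((walkExp (U p a v) g.val : ℕ) : ZMod 3) = ((walkExp a g.val : ℕ) : ZMod 3) + lin (pathRow p a g 1) v := by
  unfold walkExp
  push_cast
  rw [AffBells37.natCast_wt, AffBells37.natCast_wt, AffBells37.natCast_wtPrefix, AffBells37.natCast_wtPrefix]
  simp_rw [ind_U p a v, ind_U_lt p a v _ g.val]
  rw [sum_add_distrib, sum_add_distrib]
  have hre : ∑ i : Fin n, (if wE p v i.val = true then sg (a i) else 0)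
      + ∑ i : Fin n, (if wE p v i.val = true then (if i.val < g.val then sg (a i) else 0) else 0)
        = lin (pathRow p a g 1) v := by
    rw [sum_wE_reindex hS v (fun i => sg (a i)),
      sum_wE_reindex hS v (fun i => if i.val < g.val then sg (a i) else 0), ← sum_add_distrib]
    unfold lin pathRow
    refine sum_congr rfl fun j _ => ?_
    rw [uExt_of_lt a (by have := (hS.1 j).2; omega)]
    by_cases hv : v j = true
    · rw [if_pos hv, if_pos hv, if_pos hv]
      simp only
      by_cases hlt : p j < g.val
      · rw [if_pos hlt, if_pos hlt]; ring
      · rw [if_neg hlt, if_neg hlt]; ring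
    · rw [if_neg hv, if_neg hv, if_neg hv, add_zero]
  rw [← hre]
  abel

/-! ### The strategy, its transport, and (S1) -/

/-- the output bits of the polynomial strategy `P`: `z_g(x) = [P_g(x) = 1]`. -/
def zOf (P : Fin (n + 1) → Smolensky.CubeFn (ZMod 3) (n + 1)) (x : Fin (n + 1) → Bool) : Fin (n + 1) → Bool :=
  fun g => decide (P g x = 1)

/-- the transported walk strategy `y_g(u) = z_g(xOfU u) ⊕ t_g(xOfU u)`. -/
def yOf (P : Fin (n + 1) → Smolensky.CubeFn (ZMod 3) (n + 1)) : Fin (n + 1) → (Fin n → Bool) → Bool :=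
  fun g u => xor (zOf P (xOfU u) g) (tGuess (xOfU u) g)

/-- WIN of the transported game at charge `n + 2`. -/
def Wn (P : Fin (n + 1) → Smolensky.CubeFn (ZMod 3) (n + 1)) (u : Fin n → Bool) : Bool := ringWinU (n + 2) (yOf P) u

/-- **(S1) transport**: the odd-class wins of `P` inject into the walk-game wins. -/
theorem S1 (hn : 2 ≤ n) (P : Fin (n + 1) → Smolensky.CubeFn (ZMod 3) (n + 1)) :
    (univ.filter fun x : Fin (n + 1) → Bool => OddZeros x ∧ Rel x (zOf P x)).card
      ≤ (univ.filter fun u : Fin n → Bool => Wn P u = true).card := by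
  refine Finset.card_le_card_of_injOn uVec ?_ ?_
  · intro x hx
    rw [Finset.mem_coe, mem_filter] at hx
    rw [Finset.mem_coe, mem_filter]
    refine ⟨mem_univ _, ?_⟩
    have hodd : (univ.filter fun j : Fin (n + 1) => x j = false).card % 2 = 1 := hx.2.1
    exact (rel_iff_ringWinU hn x hodd (zOf P)).1 hx.2.2
  · intro x₁ hx₁ x₂ hx₂ h
    rw [Finset.mem_coe, mem_filter] at hx₁ hx₂
    have h1 : (univ.filter fun j : Fin (n + 1) => x₁ j = false).card % 2 = 1 := hx₁.2.1
    have h2 : (univ.filter fun j : Fin (n + 1) => x₂ j = false).card % 2 = 1 := hx₂.2.1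
    rw [← xOfU_uVec hn x₁ h1, ← xOfU_uVec hn x₂ h2, h]


end Slicing

end Summit.QuantumAdvantage.AdviceFreeQNC0.NPGamma37Proof
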